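import Mathlib.Algebra.Order.Field.Pointwise
import Mathlib.Algebra.Group.Pointwise.Set.Scalar
import Mathlib.Analysis.Calculus.FDeriv.Add
import Mathlib.LinearAlgebra.Determinant
import Mathlib.LinearAlgebra.Dimension.Constructions
import Mathlib.Topology.Algebra.Module.Determinant
import Literature.NumberTheory.Transcendental.KZCalculus

/-!
# `NormalFormPrinciple` (stmt-KontsevichZagierPeriods-3869), line `SketchIdeator1` — the dlog
# scaling move `dlog_scale_mem_relations`, Mathlib-API proof (siege k1)

The registered sub-goal `dlog_scale_mem_relations` of the lead's dlog layer of `stub_boxRigidity`: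
for rationals `a, b, c, s` with `0 < a`, `0 < s` and two integral representations
`L = [(a, b), c/y]`, `L' = [(s a, s b), c/y]` of dimension one,
`[L] − [L'] ∈ KZ.relations` — one application of rule (2) of the Kontsevich–Zagier calculus with
the dilation `Φ(y) = s • y`, whose Jacobian is `s` and for which `c/y = (c/(s y)) · s`.

The STATEMENT coincides (same registered signature) with the lead's
`…NormalFormPrinciple.PiBox.Dlog.dlog_scale_mem_relations`
(`Theorems/HurwitzMicroSectorsNormalFormPrincipleDlogMoves.lean`, seat c3); this file is the
harness-requested best-of-10 siege variant k1, "Mathlib API route". What differs is the proof and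
the dependency footprint: this file imports only `Literature.NumberTheory.Transcendental.KZCalculus`
and Mathlib (no summit-side file — the lead's proof runs through the affine-chart kit of
`TerasomaMultiplicationBetaCancellationStubAffineMove` and the `ℝ¹ ↔ ℝ` transfer lemmas of
`NormalFormPrinciple/Negative/WindowInvariant`), and every side condition of the
change-of-variables move is discharged with Mathlib's API —
`HasFDerivAt.const_smul` / `hasFDerivAt_id` (derivative of the dilation),
`smul_right_injective` (injectivity), `Set.image_smul`, `Set.smul_set_univ_pi`,
`LinearOrderedField.smul_Ioo` (image of the slab), `LinearMap.det_smul`, `LinearMap.det_id`,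
`Module.finrank_fin_fun` (the Jacobian `det (s • id) = s`) — plus the semialgebraicity of the
polynomial map `y ↦ s y` from `isSemialgebraicMapOn_aeval` (the pattern of
`KZ.bigSimplex_equivalent_constMul_dirichlet` in `Literature/…/KZDirichletScaling.lean`).

Source: M. Kontsevich, D. Zagier, *Periods* (2001), §1.2, rule (2) (change of variables).
-/

noncomputable section

open Set
open scoped Pointwise
open Literature.NumberTheory.Transcendental Literature.NumberTheory.Transcendental.KZ

namespace Summit.KontsevichZagierPeriods.HurwitzMicroSectors.NormalFormPrinciple.PiBox

namespace DlogDilation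

/-- An open slab `{x | x 0 ∈ (a, b)}` of `ℝ¹` is the one-factor box `univ.pi (fun _ => (a, b))`.
[folklore] -/
theorem slab_eq_univ_pi (a b : ℝ) :
    {x : Fin 1 → ℝ | x 0 ∈ Set.Ioo a b} = Set.univ.pi fun _ : Fin 1 => Set.Ioo a b := by
  ext x
  simp only [mem_setOf_eq, mem_univ_pi, Fin.forall_fin_one]

/-- The image of the slab `{a < y < b} ⊆ ℝ¹` under the dilation `y ↦ s • y` (`0 < s`) is the slab
`{s a < y < s b}` — by Mathlib's pointwise API (`Set.image_smul`, `Set.smul_set_univ_pi`,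
`LinearOrderedField.smul_Ioo`) rather than by elementwise inequalities. [folklore] -/
theorem image_smul_slab {s : ℝ} (hs : 0 < s) (a b : ℝ) :
    (fun y : Fin 1 → ℝ => s • y) '' {x : Fin 1 → ℝ | x 0 ∈ Set.Ioo a b} =
      {x : Fin 1 → ℝ | x 0 ∈ Set.Ioo (s * a) (s * b)} := by
  rw [slab_eq_univ_pi, slab_eq_univ_pi, Set.image_smul, Set.smul_set_univ_pi]
  congr 1
  funext i
  exact LinearOrderedField.smul_Ioo hs

/-- The Jacobian of the dilation `y ↦ s • y` of `ℝ¹`: `|det (s • id)| = s` for `0 < s`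
(Mathlib: `LinearMap.det_smul`, `LinearMap.det_id`, `Module.finrank_fin_fun`; the general
`det (c • id) = c ^ m` is `KZ.det_smul_id_fin` of `KZDirichletScaling`, not imported here to keep
this file on `KZCalculus` + Mathlib). [folklore] -/
theorem abs_det_smul_id {s : ℝ} (hs : 0 < s) :
    |((s • ContinuousLinearMap.id ℝ (Fin 1 → ℝ) : (Fin 1 → ℝ) →L[ℝ] (Fin 1 → ℝ))).det| = s := by
  rw [ContinuousLinearMap.det, ContinuousLinearMap.toLinearMap_smul, ContinuousLinearMap.coe_id,
    LinearMap.det_smul, LinearMap.det_id, Module.finrank_fin_fun, pow_one, mul_one, abs_of_pos hs]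

/-- The dilation `y ↦ s • y` by a rational `s` is a `ℚ`-semialgebraic map on every
`ℚ`-semialgebraic subset of `ℝ¹` (it is the polynomial map `C s * X 0`). [folklore] -/
theorem isSemialgebraicMapOn_smul (s : ℚ) {σ : Set (Fin 1 → ℝ)}
    (hσ : Literature.ModelTheory.ExponentialFields.IsSemialgebraic ℚ σ) :
    IsSemialgebraicMapOn ℚ σ (fun y : Fin 1 → ℝ => (s:ℝ) • y) := by
  refine (isSemialgebraicMapOn_aeval hσ
    (fun _ : Fin 1 => MvPolynomial.C s * MvPolynomial.X 0)).congr fun y _ => ?_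
  funext j
  show MvPolynomial.aeval y (MvPolynomial.C s * MvPolynomial.X 0) = (s:ℝ) * y j
  rw [Fin.fin_one_eq_zero j, map_mul, MvPolynomial.aeval_C, MvPolynomial.aeval_X, eq_ratCast]

end DlogDilation

open DlogDilation

/-- **Scaling** (rule 2) for the dlog representations: for rationals `a, b, c, s` with `0 < a` and
`0 < s`, `[(a,b), c/y] − [(sa, sb), c/y] ∈ relations` — the dilation `y ↦ s • y` maps the slab
`{a < y < b}` onto `{sa < y < sb}`, has Jacobian `s`, and `c/y = (c/(s y)) · s` on the slab.
Registered sub-goal `dlog_scale_mem_relations` of crux stmt-KontsevichZagierPeriods-3869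
(line `SketchIdeator1`, dlog layer of `stub_boxRigidity`); Mathlib-API proof.
[cite: KontsevichZagier2001, §1.2 rule (2)] -/
theorem dlog_scale_mem_relations {a b c s : ℚ} (L L' : IntegralRep 1)
    (hd : L.domain = {x | x 0 ∈ Set.Ioo (a:ℝ) b})
    (hd' : L'.domain = {x | x 0 ∈ Set.Ioo ((s * a : ℚ):ℝ) ((s * b : ℚ):ℝ)})
    (hi : EqOn L.integrand (fun x => (c:ℝ) / x 0) L.domain)
    (hi' : EqOn L'.integrand (fun x => (c:ℝ) / x 0) L'.domain) (ha : 0 < a) (hs : 0 < s) :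
    of L - of L' ∈ relations := by
  have hs' : (0:ℝ) < s := by exact_mod_cast hs
  -- the target slab is the image of the source slab under the dilation
  have himage : L'.domain = (fun y : Fin 1 → ℝ => (s:ℝ) • y) '' L.domain := by
    rw [hd, hd', image_smul_slab hs', Rat.cast_mul, Rat.cast_mul]
  refine changeOfVariablesRel_subset_relations
    ⟨1, L, L', fun y : Fin 1 → ℝ => (s:ℝ) • y,
      fun _ => (s:ℝ) • ContinuousLinearMap.id ℝ (Fin 1 → ℝ),
      isSemialgebraicMapOn_smul s L.isSemialgebraic_domain,
      fun x _ => ((hasFDerivAt_id x).const_smul (s:ℝ)).hasFDerivWithinAt,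
      (smul_right_injective (Fin 1 → ℝ) hs'.ne').injOn, himage, fun x hx => ?_, rfl⟩
  -- the integrand identity `c / y = (c / (s y)) · |det (s • id)|` on the source slab
  have hΦx : (s:ℝ) • x ∈ L'.domain := himage ▸ Set.mem_image_of_mem _ hx
  have hx0 : (0:ℝ) < x 0 := by
    rw [hd] at hx
    exact lt_trans (by exact_mod_cast ha) hx.1
  rw [hi hx, hi' hΦx, abs_det_smul_id hs']
  show (c:ℝ) / x 0 = (c:ℝ) / ((s:ℝ) • x) 0 * s
  rw [Pi.smul_apply, smul_eq_mul]
  field_simp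

end Summit.KontsevichZagierPeriods.HurwitzMicroSectors.NormalFormPrinciple.PiBox
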